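import Literature.Probability.RandomPlanarGeometry.ChordalCurveFamilyProofs
import Literature.Probability.RandomPlanarGeometry.PlanarDomainsTopology
import Literature.Topology.PlaneTopology.JordanCurveProofs
import Literature.Probability.RandomPlanarGeometry.BoundaryCorrespondence
import HarnessLib

/-!
# Deterministic simple chords, I: segments, slits and the remaining domain

Crux `SymmetryUpgradeR` (stmt-CriticalPhenomena-17239, route `CardySelfRefinement`), line `SketchIdeatorTwo`,
negative side: the lead's structural theorem behind the verdict on stubs S7 `stub_pinnedSchrammLSW` /
S5a `stub_middleDrivingMartingale` — the typed domain Markov property `ChordalFamily.IsDomainMarkov`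
cannot carry Schramm's increment argument (headline in `TiltedRayFamily.lean`:
`typedSchrammPrinciple_fails`).

This file: Jordan domains are regular open sets (`JordanDomain.interior_closure_carrier`, from the
Jordan curve theorem); affine segments `segCurve` of a curve (`Curve.stopAt` / `Curve.startFrom` are
segments at the hitting parameter); the hypothesis bundle `IsSimpleChordFamily` (for every Dobrushin
domain an injective curve from `a` to `b` inside `D`, initial slits leaving a preconnected dense
remainder, dependence on `(carrier, a, b)` only up to increasing reparametrisation) and its geometry:
the remaining domain of an initial piece is the carrier minus the slit (`remainingDomain_eq`), it
determines the carrier (`carrier_eq_interior_closure`) and the closure of the slit adds exactly `a`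
(`closure_slit_diff_carrier`). Parts II–III: `DiracChordsTrace.lean`, `DiracMarkov.lean`.

References: W. Werner, *Lectures on two-dimensional critical percolation* (2007), §3.2 (2), Lemma 3.3;
O. Schramm, Israel J. Math. 118 (2000), §1; G. F. Lawler, *Conformally Invariant Processes in the Plane*
(2005), §6.3.
-/

noncomputable section

open Set MeasureTheory Topology Filter Metric
open scoped unitInterval ENNReal NNReal
open UpperHalfPlane (upperHalfPlaneSet)

namespace Summit.CriticalPhenomena.CardyFormulaZ2.Theorems.SymmetryUpgradeR.Negative

open Literature.Probability.RandomPlanarGeometry Literature.Probability.RandomPlanarGeometry.ChordalFamily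

/-! ### Jordan domains are regular open sets -/

/-- **A Jordan domain is a regular open set**: `interior (closure D) = D`. From the Jordan curve
theorem: every boundary point is a limit of exterior points
(`JordanDomain.frontier_subset_closure_exterior`), so no boundary point is interior to the closure.
[folklore] -/
theorem JordanDomain.interior_closure_carrier (D : JordanDomain) :
    interior (closure D.carrier) = D.carrier := by
  refine Subset.antisymm ?_ (D.isOpen.subset_interior_iff.2 subset_closure)
  intro y hy
  by_contra hyD
  have hyf : y ∈ frontier D.carrier := by
    rw [frontier_eq_closure_inter_closure]
    exact ⟨interior_subset hy, subset_closure hyD⟩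
  have hy' : y ∈ closure (closure D.carrier)ᶜ :=
    D.frontier_subset_closure_exterior Literature.Topology.PlaneTopology.JordanCurveTheorem_holds hyf
  rw [mem_interior_iff_mem_nhds] at hy
  rw [mem_closure_iff_nhds] at hy'
  obtain ⟨w, hw, hw'⟩ := hy' _ hy
  exact hw' hw

/-! ### Affine segments of a curve -/

section Seg

variable {E : Type*} [TopologicalSpace E]

/-- The affine segment `s ↦ γ (a + b s)` (clamped to `[0, 1]`) of a curve. With `a = 0`, `b = r` it
is the initial piece up to parameter `r`; with `a = r`, `b = 1 - r` the final piece from `r`;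
`Curve.stopAt` / `Curve.startFrom` are these at the hitting parameter. [folklore] -/
def segCurve (γ : Curve E) (a b : ℝ) : Curve E :=
  ⟨γ.toContinuousMap.comp (Curve.affineClamp a b)⟩

/-- Pointwise formula for `segCurve`. [folklore] -/
theorem segCurve_apply (γ : Curve E) (a b : ℝ) (s : I) :
    segCurve γ a b s = γ (projIcc 0 1 zero_le_one (a + b * s)) := by
  simp [segCurve, ← Curve.coe_toContinuousMap]

/-- `stopAt F` is the initial segment at the hitting parameter. [folklore] -/
theorem stopAt_eq_segCurve (F : Set E) (γ : Curve E) :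
    γ.stopAt F = segCurve γ 0 (γ.hitParam F) := rfl

/-- `startFrom F` is the final segment at the hitting parameter. [folklore] -/
theorem startFrom_eq_segCurve (F : Set E) (γ : Curve E) :
    γ.startFrom F = segCurve γ (γ.hitParam F) (1 - γ.hitParam F) := rfl

/-- The initial segment at parameter `0` is the constant curve at the source. [folklore] -/
theorem segCurve_zero_zero (γ : Curve E) : segCurve γ 0 0 = Curve.const (γ 0) := by
  refine Curve.ext (ContinuousMap.ext fun s => ?_)
  change segCurve γ 0 0 s = γ 0
  rw [segCurve_apply]
  congr 1
  ext
  simp [projIcc]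

/-- The final segment from parameter `0` is the whole curve. [folklore] -/
theorem segCurve_zero_one (γ : Curve E) : segCurve γ 0 1 = γ := by
  refine Curve.ext (ContinuousMap.ext fun s => ?_)
  change segCurve γ 0 1 s = γ s
  rw [segCurve_apply]
  simp [projIcc_val zero_le_one s]

/-- The final segment from parameter `1` is the constant curve at the target. [folklore] -/
theorem segCurve_one_zero (γ : Curve E) : segCurve γ 1 0 = Curve.const (γ 1) := by
  refine Curve.ext (ContinuousMap.ext fun s => ?_)
  change segCurve γ 1 0 s = γ 1
  rw [segCurve_apply]
  congr 1
  ext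
  simp [projIcc]

/-- Value of the initial segment `segCurve γ 0 r` at time `1`: the point `γ r`. [folklore] -/
theorem segCurve_zero_apply_one (γ : Curve E) {r : ℝ} (hr : r ∈ Icc (0 : ℝ) 1) :
    segCurve γ 0 r 1 = γ ⟨r, hr⟩ := by
  rw [segCurve_apply]
  congr 1
  ext
  simp [projIcc_of_mem _ hr]

/-- Value of the final segment `segCurve γ r (1 - r)` at time `0`: the point `γ r`. [folklore] -/
theorem segCurve_apply_zero (γ : Curve E) {r : ℝ} (hr : r ∈ Icc (0 : ℝ) 1) :
    segCurve γ r (1 - r) 0 = γ ⟨r, hr⟩ := by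
  rw [segCurve_apply]
  congr 1
  ext
  simp [projIcc_of_mem _ hr]

/-- The trace of the initial segment `segCurve γ 0 r` (`0 ≤ r ≤ 1`) is the image of `[0, r]`. [folklore] -/
theorem range_segCurve_zero (γ : Curve E) {r : ℝ} (hr : r ∈ Icc (0 : ℝ) 1) :
    Set.range (segCurve γ 0 r) = γ '' {s : I | (s : ℝ) ≤ r} := by
  ext x
  simp only [Set.mem_range, mem_image, mem_setOf_eq]
  constructor
  · rintro ⟨s, rfl⟩
    rw [segCurve_apply]
    have hmem : 0 + r * (s : ℝ) ∈ Icc (0 : ℝ) 1 := by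
      constructor
      · nlinarith [hr.1, s.2.1]
      · nlinarith [hr.2, s.2.2, s.2.1, hr.1]
    refine ⟨projIcc 0 1 zero_le_one (0 + r * s), ?_, rfl⟩
    rw [projIcc_of_mem _ hmem]
    show 0 + r * (s : ℝ) ≤ r
    nlinarith [hr.2, s.2.2, s.2.1, hr.1]
  · rintro ⟨t, ht, rfl⟩
    rcases eq_or_lt_of_le hr.1 with hr0 | hr0
    · -- r = 0 : t = 0
      have ht0 : (t : ℝ) = 0 := le_antisymm (hr0 ▸ ht) t.2.1
      refine ⟨0, ?_⟩
      rw [segCurve_apply]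
      congr 1
      ext
      simp [projIcc, ht0]
    · refine ⟨⟨(t : ℝ) / r, div_nonneg t.2.1 hr.1, (div_le_one hr0).2 ht⟩, ?_⟩
      rw [segCurve_apply]
      congr 1
      ext
      have : 0 + r * ((t : ℝ) / r) = t := by field_simp; ring
      simp only [this, projIcc_val zero_le_one t]

end Seg

/-! ### Deterministic simple chord families -/

/-- A **deterministic simple chord family**: for every Dobrushin domain `(D; a, b)` an injective curve
`c D` from `a` to `b` whose interior runs inside `D`, whose initial slits `c D (0, r]` (`r < 1`) leave
a preconnected, dense remainder of `D`, and which depends on `D` only through `(D.carrier, a, b)` up to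
an increasing reparametrisation. (Hyperbolic geodesics and their tilted analogues are such.) [folklore] -/
structure IsSimpleChordFamily (c : DobrushinDomain → Curve ℂ) : Prop where
  /-- the chord starts at `a` -/
  apply_zero : ∀ D, c D 0 = D.pt 0
  /-- the chord ends at `b` -/
  apply_one : ∀ D, c D 1 = D.pt 1
  /-- its interior runs inside the domain -/
  mem_carrier : ∀ D (s : I), 0 < (s : ℝ) → (s : ℝ) < 1 → c D s ∈ D.carrier
  /-- it is injective -/
  injective : ∀ D, Function.Injective (c D)
  /-- an initial slit does not disconnect the domain -/
  isPreconnected_diff : ∀ D (r : ℝ), r < 1 →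
    IsPreconnected (D.carrier \ c D '' {s : I | 0 < (s : ℝ) ∧ (s : ℝ) ≤ r})
  /-- an initial slit is nowhere dense in the domain -/
  subset_closure_diff : ∀ D (r : ℝ), r < 1 →
    D.carrier ⊆ closure (D.carrier \ c D '' {s : I | 0 < (s : ℝ) ∧ (s : ℝ) ≤ r})
  /-- the chord depends on `(carrier, a, b)` only, up to increasing reparametrisation -/
  exists_reparam : ∀ D₁ D₂ : DobrushinDomain, D₁.carrier = D₂.carrier → D₁.pt 0 = D₂.pt 0 →
    D₁.pt 1 = D₂.pt 1 → ∃ φ : I ≃o I, c D₂ = (c D₁).reparam φ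

namespace IsSimpleChordFamily

variable {c : DobrushinDomain → Curve ℂ} (hc : IsSimpleChordFamily c)
include hc

/-- The slit `c D (0, r]` lies in the domain (`r < 1`). [folklore] -/
theorem slit_subset (D : DobrushinDomain) {r : ℝ} (hr : r < 1) :
    c D '' {s : I | 0 < (s : ℝ) ∧ (s : ℝ) ≤ r} ⊆ D.carrier := by
  rintro _ ⟨s, ⟨hs0, hsr⟩, rfl⟩
  exact hc.mem_carrier D s hs0 (hsr.trans_lt hr)

/-- `c D s = a` only at `s = 0`. [folklore] -/
theorem eq_zero_of_apply_eq_pt_zero (D : DobrushinDomain) {s : I} (h : c D s = D.pt 0) : s = 0 :=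
  hc.injective D (h.trans (hc.apply_zero D).symm)

/-- `c D s = b` only at `s = 1`. [folklore] -/
theorem eq_one_of_apply_eq_pt_one (D : DobrushinDomain) {s : I} (h : c D s = D.pt 1) : s = 1 :=
  hc.injective D (h.trans (hc.apply_one D).symm)

/-- The unexplored part of the domain after the initial piece up to parameter `r < 1` is the domain
minus the slit `c D (0, r]`. [folklore] -/
theorem carrier_diff_range (D : DobrushinDomain) {r : ℝ} (hr : r ∈ Icc (0 : ℝ) 1) (hr1 : r < 1) :
    D.carrier \ Set.range (segCurve (c D) 0 r) =
      D.carrier \ c D '' {s : I | 0 < (s : ℝ) ∧ (s : ℝ) ≤ r} := by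
  have _ := hr1
  rw [range_segCurve_zero _ hr]
  ext z
  constructor
  · rintro ⟨hz, hnot⟩
    refine ⟨hz, ?_⟩
    rintro ⟨s, ⟨-, hsr⟩, rfl⟩
    exact hnot ⟨s, hsr, rfl⟩
  · rintro ⟨hz, hnot⟩
    refine ⟨hz, ?_⟩
    rintro ⟨s, hsr, hzs⟩
    rcases eq_or_lt_of_le s.2.1 with hs0 | hs0
    · have : s = 0 := Subtype.ext hs0.symm
      subst this
      refine D.pt_notMem_carrier 0 ?_
      rw [← hc.apply_zero D, hzs]
      exact hz
    · exact hnot ⟨s, ⟨hs0, hsr⟩, hzs⟩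

/-- `b` lies in the closure of the domain minus an initial slit (`r < 1`): it is the limit of the
chord's own later points. [folklore] -/
theorem pt_one_mem_closure_diff (D : DobrushinDomain) {r : ℝ} (hr1 : r < 1) :
    D.pt 1 ∈ closure (D.carrier \ c D '' {s : I | 0 < (s : ℝ) ∧ (s : ℝ) ≤ r}) := by
  rw [← hc.apply_one D]
  have hcont : Tendsto (c D) (𝓝[<] (1 : I)) (𝓝 (c D 1)) :=
    ((c D).continuous.tendsto 1).mono_left nhdsWithin_le_nhds
  haveI : (𝓝[<] (1 : I)).NeBot := nhdsLT_neBot_of_exists_lt ⟨0, zero_lt_one⟩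
  refine mem_closure_of_tendsto hcont ?_
  set r' : I := ⟨max r 0, le_max_right _ _, max_le hr1.le zero_le_one⟩ with hr'
  have hlt : r' < 1 := by
    change max r 0 < (1 : ℝ)
    exact max_lt hr1 zero_lt_one
  have hmem : Ioo r' 1 ∈ 𝓝[<] (1 : I) := Ioo_mem_nhdsLT hlt
  filter_upwards [hmem] with s hs
  have hs1 : (s : ℝ) < 1 := hs.2
  have hrs : r < (s : ℝ) := (le_max_left r 0).trans_lt hs.1
  have hs0 : (0 : ℝ) < s := (le_max_right r 0).trans_lt hs.1
  refine ⟨hc.mem_carrier D s hs0 hs1, ?_⟩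
  rintro ⟨t, ⟨-, htr⟩, hts⟩
  have := hc.injective D hts
  subst this
  exact absurd htr (not_le.2 hrs)

/-- **The remaining domain of an initial piece** up to parameter `r < 1` is the domain minus the
slit `c D (0, r]`. [folklore] -/
theorem remainingDomain_eq (D : DobrushinDomain) {r : ℝ} (hr : r ∈ Icc (0 : ℝ) 1) (hr1 : r < 1) :
    remainingDomain D (CurveClass.mk (segCurve (c D) 0 r)) =
      D.carrier \ c D '' {s : I | 0 < (s : ℝ) ∧ (s : ℝ) ≤ r} := by
  have hW := hc.carrier_diff_range D hr hr1
  ext z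
  simp only [remainingDomain, CurveClass.range_mk, Curve.range, mem_setOf_eq]
  rw [hW]
  constructor
  · exact fun h => h.1
  · intro hz
    refine ⟨hz, ?_⟩
    have hcomp : connectedComponentIn (D.carrier \ c D '' {s : I | 0 < (s : ℝ) ∧ (s : ℝ) ≤ r}) z =
        D.carrier \ c D '' {s : I | 0 < (s : ℝ) ∧ (s : ℝ) ≤ r} :=
      Subset.antisymm (connectedComponentIn_subset _ _)
        ((hc.isPreconnected_diff D r hr1).subset_connectedComponentIn hz Subset.rfl)
    rw [hcomp]
    exact hc.pt_one_mem_closure_diff D hr1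

/-- **The remaining domain determines the carrier**: `D = interior (closure (remaining domain))`
(the slit is nowhere dense and Jordan domains are regular open). [folklore] -/
theorem carrier_eq_interior_closure (D : DobrushinDomain) {r : ℝ} (hr1 : r < 1) :
    D.carrier = interior (closure (D.carrier \ c D '' {s : I | 0 < (s : ℝ) ∧ (s : ℝ) ≤ r})) := by
  refine Subset.antisymm (D.isOpen.subset_interior_iff.2 (hc.subset_closure_diff D r hr1)) ?_
  calc interior (closure (D.carrier \ c D '' {s : I | 0 < (s : ℝ) ∧ (s : ℝ) ≤ r}))
      ⊆ interior (closure D.carrier) := interior_mono (closure_mono Set.sdiff_subset)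
    _ = D.carrier := JordanDomain.interior_closure_carrier D.toJordanDomain

/-- **The closure of a nonempty initial slit adds exactly `a`** outside the domain:
`closure (c D (0, r]) ∖ D = {a}` for `0 < r < 1`. [folklore] -/
theorem closure_slit_diff_carrier (D : DobrushinDomain) {r : ℝ} (hr0 : 0 < r) (hr : r ∈ Icc (0 : ℝ) 1)
    (hr1 : r < 1) :
    closure (c D '' {s : I | 0 < (s : ℝ) ∧ (s : ℝ) ≤ r}) \ D.carrier = {D.pt 0} := by
  apply Subset.antisymm
  · -- `closure (slit) ⊆ c D [0, r] = {a} ∪ slit`, and the slit lies in `D`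
    rintro z ⟨hz, hzD⟩
    have hcl : closure (c D '' {s : I | 0 < (s : ℝ) ∧ (s : ℝ) ≤ r}) ⊆ c D '' {s : I | (s : ℝ) ≤ r} := by
      refine closure_minimal (image_mono fun s hs => hs.2) ?_
      have hK : IsCompact {s : I | (s : ℝ) ≤ r} :=
        (isClosed_le continuous_subtype_val continuous_const).isCompact
      exact (hK.image (c D).continuous).isClosed
    obtain ⟨s, hs, rfl⟩ := hcl hz
    rcases eq_or_lt_of_le s.2.1 with hs0 | hs0
    · have : s = 0 := Subtype.ext hs0.symm
      subst this
      exact hc.apply_zero D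
    · exact absurd (hc.mem_carrier D s hs0 (lt_of_le_of_lt hs hr1)) hzD
  · rintro z rfl
    refine ⟨?_, D.pt_notMem_carrier 0⟩
    rw [← hc.apply_zero D]
    have hcont : Tendsto (c D) (𝓝[>] (0 : I)) (𝓝 (c D 0)) :=
      ((c D).continuous.tendsto 0).mono_left nhdsWithin_le_nhds
    haveI : (𝓝[>] (0 : I)).NeBot := nhdsGT_neBot_of_exists_gt ⟨1, zero_lt_one⟩
    refine mem_closure_of_tendsto hcont ?_
    have hmem : Ioo (0 : I) ⟨r, hr⟩ ∈ 𝓝[>] (0 : I) := Ioo_mem_nhdsGT (show (0 : I) < ⟨r, hr⟩ from hr0)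
    filter_upwards [hmem] with s hs
    exact ⟨s, ⟨hs.1, le_of_lt hs.2⟩, rfl⟩

end IsSimpleChordFamily

/-- Registered form (crux stmt-CriticalPhenomena-17239, `--supports`): **Jordan domains are regular
open sets.** [folklore] -/
theorem jordanDomain_interior_closure :
    ∀ D : JordanDomain, interior (closure D.carrier) = D.carrier :=
  JordanDomain.interior_closure_carrier

end Summit.CriticalPhenomena.CardyFormulaZ2.Theorems.SymmetryUpgradeR.Negative

end
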